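import Literature.NumberTheory.PAdicHodge.BmaxPlusBdRModFil
import HarnessLib

/-!
# The comparison `B_max⁺ → B_dR⁺/Fil^k` is `Γ_F`-equivariant

Topic `Literature/NumberTheory/PAdicHodge`; namespace `Literature.NumberTheory.PAdicHodge`. THEOREMS ONLY (no definition, no named
fact, no instance, no `sorry`). Sequel of `BmaxPlusBdRModFil` (`exists_bdR_lim_modFil`). The Galois group `Γ_F` acts on
`B⁰_max ⊂ B_max⁺` (`galBmaxZero`, `galBmaxPlus`) and on `B_dR⁺` (`galBdRPlus`), all induced by `𝕎(σ♭)[1/p]` on `𝔸_inf[1/p]`; it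
preserves Fontaine's lattices `Λ(N, k) = p^N ι(𝔸_inf) + ξ^k B_dR⁺` (`σ(ξ) ∈ ξ·B_dR⁺`). Hence:

* `evalₐ_galBmaxPlus_of_eq` — levels of `σ(x)`: `σ(x) ≡ σ⁰(y) (mod p^M)` if `x ≡ y`;
* `galBdRPlus_algebraMap_coe` — `σ(ι₀ y) = ι₀(σ⁰ y)` for `y ∈ B⁰_max`;
* `lattice_galBdRPlus` — `σ(Λ(N, k)) ⊆ Λ(N, k)`;
* ★ `bdR_lim_modFil_galBmaxPlus` — **if `L` is a limit of `x` modulo `Fil^k` then `σ(L)` is a limit of `σ(x)` modulo `Fil^k`** (same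
  shift): the comparison `B_max⁺ → B_dR⁺/Fil^k` commutes with `Γ_F`.

Brick B5 of the φ-road of line `kato_lever` (crux K★ `stmt-BirchSwinnertonDyer-22226`); infrastructure only, BSD / K★ are not proved by this.

## References
* [Colmez1998Annals] P. Colmez, *Théorie d'Iwasawa des représentations de de Rham d'un corps local*, Ann. of Math. 148 (1998), §III.2.
* [FontaineAsterisque223III] J.-M. Fontaine, *Le corps des périodes p-adiques*, Astérisque 223 (1994), Exp. II §1.5.3–1.5.5.
-/

noncomputable section

open WittVector Field ValuativeRel Polynomial Finset
open Literature.AlgebraicGeometry.Resolution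

namespace Literature.NumberTheory.PAdicHodge

open Literature.NumberTheory.GaloisRepresentations
open Literature.NumberTheory.GaloisRepresentations.IsNonarchimedeanLocalField

variable {F : Type} [Field F] [ValuativeRel F] [TopologicalSpace F] [IsNonarchimedeanLocalField F]
  [CharZero F] {p : ℕ} [Fact p.Prime] [Fact (¬ IsUnit (p : integerC F))]
  [IsAdicComplete (Ideal.span {(p : integerC F)}) (integerC F)]

set_option maxHeartbeats 1600000 in
/-- **Levels of `σ(x)`**: if `x ≡ y (mod p^M)` in `B_max⁺` then `σ(x) ≡ σ⁰(y) (mod p^M)`. [cite: BergerLaurent2002, §1.2] -/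
theorem evalₐ_galBmaxPlus_of_eq (σ : absoluteGaloisGroup F) (M : ℕ) {x : BmaxPlus F p} {y : bmaxZero F p}
    (hx : AdicCompletion.evalₐ (Ideal.span {(p : bmaxZero F p)}) M x = Ideal.Quotient.mk _ y) :
    AdicCompletion.evalₐ (Ideal.span {(p : bmaxZero F p)}) M (galBmaxPlus σ x) = Ideal.Quotient.mk _ (galBmaxZero σ y) := by
  unfold galBmaxPlus
  rw [evalₐ_adicCompletionMap, hx, Ideal.quotientMap_mk]

/-- **`σ(ι₀ y) = ι₀(σ⁰ y)`** for `y ∈ B⁰_max` (both actions are induced by `𝕎(σ♭)[1/p]`). [cite: FontaineAsterisque223III, Exp. II §1.5] -/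
theorem galBdRPlus_algebraMap_coe (σ : absoluteGaloisGroup F) (y : bmaxZero F p) :
    galBdRPlus σ (algebraMap (Localization.Away (p : Ainf (p := p) F)) (BDeRhamPlus (integerC F) p) (y : Localization.Away (p : Ainf (p := p) F))) =
      algebraMap (Localization.Away (p : Ainf (p := p) F)) (BDeRhamPlus (integerC F) p)
        ((galBmaxZero σ y : bmaxZero F p) : Localization.Away (p : Ainf (p := p) F)) := by
  rw [algebraMap_bDeRhamPlus_apply, algebraMap_bDeRhamPlus_apply, galBdRPlus_of, coe_galBmaxZero]

/-- **`Γ_F` preserves the lattices**: `σ(ι(p^N a) + ξ^k w) = ι(p^N σa) + ξ^k w'`. [cite: FontaineAsterisque223III, Exp. II §1.5.3] -/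
theorem lattice_galBdRPlus (σ : absoluteGaloisGroup F) {x : BDeRhamPlus (integerC F) p} {N k : ℕ} {a : Ainf (p := p) F}
    {w : BDeRhamPlus (integerC F) p} (hx : x = ainfToBdR ((p : Ainf (p := p) F) ^ N * a) + xiBdR ^ k * w) :
    ∃ w' : BDeRhamPlus (integerC F) p, galBdRPlus σ x = ainfToBdR ((p : Ainf (p := p) F) ^ N * galAinf σ a) + xiBdR ^ k * w' := by
  obtain ⟨w', hw'⟩ := GaloisContinuity.exists_galBdRPlus_xiBdR_pow_mul σ k w
  refine ⟨w', ?_⟩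
  rw [hx, map_add, hw', galBdRPlus_ainfToBdR, map_mul, map_pow, map_natCast]

set_option maxHeartbeats 3200000 in
/-- ★ **The comparison commutes with `Γ_F`**: if `L ∈ B_dR⁺` is a limit of `x ∈ B_max⁺` modulo `Fil^k` (in the sense of
`exists_bdR_lim_modFil`, shift `r`), then `σ(L)` is a limit of `σ(x)` modulo `Fil^k` with the same shift.
[cite: Colmez1998Annals, §III.2] [cite: FontaineAsterisque223III, Exp. II §1.5.3] -/
theorem bdR_lim_modFil_galBmaxPlus (σ : absoluteGaloisGroup F) {x : BmaxPlus F p} {k : ℕ} {L : BDeRhamPlus (integerC F) p} {r : ℕ}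
    (h : ∀ N M : ℕ, N + r ≤ M → ∀ y : bmaxZero F p,
      AdicCompletion.evalₐ (Ideal.span {(p : bmaxZero F p)}) M x = Ideal.Quotient.mk _ y →
      ∃ (a : Ainf (p := p) F) (w : BDeRhamPlus (integerC F) p),
        (p : BDeRhamPlus (integerC F) p) ^ k *
            (L - algebraMap (Localization.Away (p : Ainf (p := p) F)) (BDeRhamPlus (integerC F) p)
              (y : Localization.Away (p : Ainf (p := p) F))) =
          ainfToBdR ((p : Ainf (p := p) F) ^ N * a) + xiBdR ^ k * w) :
    ∀ N M : ℕ, N + r ≤ M → ∀ y : bmaxZero F p,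
      AdicCompletion.evalₐ (Ideal.span {(p : bmaxZero F p)}) M (galBmaxPlus σ x) = Ideal.Quotient.mk _ y →
      ∃ (a : Ainf (p := p) F) (w : BDeRhamPlus (integerC F) p),
        (p : BDeRhamPlus (integerC F) p) ^ k *
            (galBdRPlus σ L - algebraMap (Localization.Away (p : Ainf (p := p) F)) (BDeRhamPlus (integerC F) p)
              (y : Localization.Away (p : Ainf (p := p) F))) =
          ainfToBdR ((p : Ainf (p := p) F) ^ N * a) + xiBdR ^ k * w := by
  intro N M hM y' hy'
  obtain ⟨y, hy⟩ := Ideal.Quotient.mk_surjective (AdicCompletion.evalₐ (Ideal.span {(p : bmaxZero F p)}) M x)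
  obtain ⟨a, w, e⟩ := h N M hM y hy.symm
  -- `σ⁰(y)` represents `σ(x)` at level `M`; `σ⁰(y) − y' ∈ p^M B⁰_max ⊆ p^N B⁰_max`
  have hσy := evalₐ_galBmaxPlus_of_eq σ M hy.symm
  have hsub : galBmaxZero σ y - y' ∈ Ideal.span {(p : bmaxZero F p)} ^ N :=
    Ideal.pow_le_pow_right (show N ≤ M by omega) (sub_mem_pow_of_evalₐ_eq le_rfl hy' hσy)
  obtain ⟨a', w', e'⟩ := exists_natCast_pow_mul_algebraMap_coe_eq_of_mem_pow hsub k
  -- transport `e` along `σ`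
  obtain ⟨w'', e''⟩ := lattice_galBdRPlus σ e
  rw [map_mul, map_pow, map_natCast, map_sub, galBdRPlus_algebraMap_coe] at e''
  refine ⟨galAinf σ a + a', w'' + w', ?_⟩
  have e0 : algebraMap (Localization.Away (p : Ainf (p := p) F)) (BDeRhamPlus (integerC F) p)
      ((galBmaxZero σ y - y' : bmaxZero F p) : Localization.Away (p : Ainf (p := p) F)) =
      algebraMap (Localization.Away (p : Ainf (p := p) F)) (BDeRhamPlus (integerC F) p)
          ((galBmaxZero σ y : bmaxZero F p) : Localization.Away (p : Ainf (p := p) F)) -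
        algebraMap (Localization.Away (p : Ainf (p := p) F)) (BDeRhamPlus (integerC F) p) (y' : Localization.Away (p : Ainf (p := p) F)) := by
    rw [Subalgebra.coe_sub, map_sub]
  rw [e0] at e'
  simp only [map_add, map_mul, map_pow, map_natCast] at e' e'' ⊢
  linear_combination e'' + e'

end Literature.NumberTheory.PAdicHodge

end
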